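import Summits.CriticalPhenomena.SAWScalingLimit.Theses.SAWDefectDecoherence
import Summits.CriticalPhenomena.SAWScalingLimit.Theorems.ObservableToSLE.Negative.Identification
import HarnessLib.Audit

/-!
# Line `bridge-gate-renewal` — crux `SAWDefectDecoherence.ObservableToSLER`
(stmt-CriticalPhenomena-14005; shared by routes SAWDefectDecoherence (primary), SAWPhaseRetrieval,
SAWWindingAlias (decl `ObservableToSLE`), SAWResidueField; `Iff.rfl`-identical to item 10472
`SAWDevelopingMap.ObservableToSLE`, Disproof §1)

Skeleton (crux-plan, round 1) of the idea card `Ideas/bridge-gate-renewal.md` (ideator 2), MERGED as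
the triage panel asked (3 × pass, "bridge-gate-renewal ≈ bridge-point-germ-transfer") with the typing
of `Ideas/bridge-point-germ-transfer.md` (ideator 3): a-priori input in `RenewalAccumulation` shape
(`∀ ε ∃ r ∃ ρ ∀ᶠ δ`, both endpoints, over `hexSAWLaw`), window radius `ρ` chosen AFTER the scale
(cusps), orientation transfer a crux-rank stub, K2 local two-ball and uniform over the carvings.

THE LINE.  By the landed soft half `Negative.Identification.convergesInLawToSLE_of_identification`
the crux is `R → HexTight → (every probability subsequential limit law of the critical hexagonal SAW
in (D; a_δ, b_δ) is the chordal SLE(8/3) law)`, for EVERY Dobrushin domain and endpoint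
approximation — while `R := HexObservableLimitR` speaks only about domains flat-pinned (horizontal,
domain above, exact half-lattice balls) at BOTH marked points (Disproof §4, §8, §9: the crux is
irreducibly a TRANSFER statement).  The transfer tool of this line is the walk's OWN renewal
structure:

* GATES.  Around the lattice root `a_δ` take the lattice hexagons `hexBall a_δ n`, `nδ ∈ [r, R]`.
  The walk first leaves the level-`n` hexagon through a lattice edge `{p, q}`; the hexagon side
  through that edge, continued inside `Ω` up to `∂Ω`, is a CROSSCUT `gateCut` of the Jordan domain,
  with a root side `U = gateSide` (∋ `a_δ`) and a far side `V`.  The level is GOOD (`IsGoodGate`) if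
  the walk never returns to `U` after `{p,q}` (single crossing: Kesten's bridge point /
  Alberts–Duminil-Copin's bridge line, radialised and bent along `∂Ω`) and the gate carries a clean
  flat window of radius `ρ` (`HasCleanWindow`: the `ρ`-ball around `q` lies in `Ω` and membership in
  `U` is there EXACTLY a signed-row condition `rowOf k · ≤ rowOf k p`).  Same at `b_δ`, read backwards.
* EXACT FACTORISATION (`GateDecomposition`, stub 1, the lever).  On the event "first good gates
  `(n;p,q)` at `a_δ`, `(n';p',q')` at `b_δ`, prefix `l₁`, suffix `l₂`" the walk is `l₁ ++ mid ++ l₂`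
  with `mid` an ARBITRARY critical SAW of `Ω_δ` from `q` to `q'` avoiding `U_δ ∪ U'_δ`, weights
  multiply: conditionally the middle piece is EXACTLY the critical SAW of the lattice domain
  `Ω_δ ∖ (U_δ ∪ U'_δ)` — a chordal SAW of the Jordan domain `V ∩ V'` between two boundary points lying
  on flat zigzag sides ON lattice lines, with exact half-lattice balls of radius `ρ` at both: verbatim
  an instance of the two-ball flat-pinned class of `R`, up to the ORIENTATIONS of the two sides
  (`R` is class `(1,1)` only — Disproof §8 `obsLimitRBody_of_relativeClass_ne`; hence stub 3).
* ABUNDANCE (`RenewalAccumulation`, stub 2, the one new a-priori input): with probability `→ 1`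
  (`r → 0` after `R`, `ρ` after `r`) good gates exist at both ends.
* IDENTIFICATION OF THE MIDDLE PIECES (`CarvedToSLE`, stub 5, from `R6` + `HexTight` +
  `SLELawContinuity` + the cell structure of stub 1): the carved middle laws are close to SLE(8/3) of `(D; a, b)` uniformly in
  probability over the walk's own first good gates, once `R` is small: identification in the
  lattice-flat two-ball class (the business of the restriction lines of crux 10472, local version, all
  orientations, uniformly along convergent cut data) + Radó (`SLELawContinuity`, stub 4, tree facts):
  the removed root sides have diameter `→ 0` (they are bounded by the crosscut and the SHORT arc of
  `∂D`), so the cut Jordan domains have boundary loops uniformly close to `∂D`.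
* ASSEMBLY (`stub_gateTransfer`, stub 6, soft): decompose `hexSAWLaw` on the good event into cells,
  apply stub 1 per cell, compare the full curve with the middle curve (distance `≤ 3R` in
  `CurveClass ℂ`, Lipschitz test functions), sum the cell weights against stub 5, let `δ → 0` along the
  subsequence, then `ε, R → 0`: every subsequential limit is the SLE(8/3) law (`FullIdentification`).

Nothing is ever evaluated at a rough root, a slit tip or a deep endpoint: the singular object (the
law of the prefix inside the level hexagon) is DISCARDED, and `R` is consumed only inside its literal
class (rigid exact balls at both re-rooted points — Disproof §5 `not_rootFree` honoured by
construction; the gates lie ON lattice lines, so the exact-half-lattice clause is automatic — §7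
`canonical_not_halfLattice` does not arise).

REGISTERED STUBS (6) and composition `ObservableToSLER_of` (sorry-free, concludes the crux BY NAME
through `convergesInLawToSLE_of_identification`):
1. `stub_gateDecomposition : GateDecomposition` — M, provable now (the first lemma, law level).
2. `stub_renewalAccumulation : RenewalAccumulation` — XL, OPEN; HARDEST and load-bearing.
3. `stub_orientationTransfer : HexObservableLimitR → HexObservableLimitR6` — OPEN (locality species)
   under `R` as typed; TRIVIAL if the route planners re-type item 14003's two ball clauses with
   independent lattice orientations (recommended by all three triagers and Disproof §8; immune to
   the 5420 corridor witness for the same reason `R` is).  `hexObservableLimitR_of_R6` checks the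
   converse specialisation `R6 → R` (so `R6` is typed consistently with `R`).
4. `stub_sleLawContinuity : SLELawContinuity` — M–L, provable now from tree facts (Radó).
5. `stub_carvedToSLE : GateDecomposition → HexObservableLimitR6 → HexTight → SLELawContinuity →
   CarvedToSLE` — XL, OPEN (Conj.-2-class identification; shared in substance with the lines of
   crux 10472; `GateDecomposition` is handed in because the middle piece is a sub-arc of the whole
   walk exactly on the cells of stub 1, which is how `HexTight` yields tightness in average).
6. `stub_gateTransfer : GateDecomposition → RenewalAccumulation → CarvedToSLE → HexTight →
   FullIdentification` — L, provable now (soft measure theory + planar topology of crosscuts).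

DEFINITIONS.  The line's objects (`rowCoord`, `rowOf`, `hexBall`, `skewCoord`, `contHex`,
`gatePoint`, `gateCut`, `gateSide`, `sideVerts`, `HasCleanWindow`, `IsFirstExit`, `IsGoodGate`,
`IsFirstGoodGate`, `GoodRenewalAt`, `carvedWeight`, `carvedLaw`) and its typed statements are
declared HERE; the lead should land the `## Vocabulary` + `## Typed statements` blocks verbatim as a
definitions file `Theorems/SAWDefectDecoherenceObservableToSLERGateDefs.lean` (precedent:
`Theorems/SAWDevelopingMapHexTightReversalDefs.lean`) so that stub files under `Theorems/` and the
skeleton share ONE copy, then re-run `ledger skeleton check` (signatures are stated over these names).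

Disproof.lean (cdisprove gen 2) honoured: §2 no `_false_without_` theorem exists (nothing to use an
`H` for); §5 `not_rootFree` — every use of `R`/`R6` keeps rigid exact half-lattice balls at BOTH
points (stub 5's class); §7 — gates on lattice lines; §8 `obsLimitRBody_of_relativeClass_ne`,
`perDomain_tilted` — stub 3 is exactly the missing orientation transfer, ranked, not hidden; §9
`crux_of_perDomain`/`perDomain_disc` — the line IS a transfer (R on the flat class ⟶ every D via
gates + Radó), never consumes `R` at the target domain; §10 RA audit (no junk instance of the
`RenewalAccumulation` shape; the lattice core is the non-slowly-varying bridge-height tail at `x_c`)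
— our `RenewalAccumulation` has the audited quantifier shape with crosscut sides in place of inner
components and a free upper scale; §12 `not_rootRenewal` concerns card 1's `RootRenewal`, not used.
Negatives index (9): 5420 (root-free `R`) avoided as above; 0772 (all-δ tightness) — only the
eventual `HexTight` is used, as a hypothesis; 8261/8312 and the percolation items are unrelated.
-/

noncomputable section

open scoped BigOperators Topology NNReal ENNReal Classical BoundedContinuousFunction
open Filter Set MeasureTheory Metric
open Literature.Probability.LatticeModels (HexVertex hexGraph hexCenter triZeta Site)
open Literature.Probability.RandomPlanarGeometry
open Literature.Probability.RandomPlanarGeometry.SAW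

namespace Summit.CriticalPhenomena.SAWScalingLimit.Cruxes.ObservableToSLER.BridgeGateRenewal

open Summit.CriticalPhenomena.SAWScalingLimit.Theses.SAWDefectDecoherence
  (HexObservableLimitR HexTight ObservableToSLER)

/-! ## Vocabulary of the line: rows, lattice hexagons, crosscuts, gates, the carved law -/

/-- The three UNSIGNED zigzag-row coordinates of a honeycomb vertex `v = (x, t)` (cell `x ∈ ℤ²`,
triangle type `t`): family `0` = horizontal rows, index `x 1` (the row function of
`HexObservableLimitR`'s exact half-lattice clause); family `1` = rows of direction `60°`, index `x 0`;
family `2` = rows of direction `120°`, index `x 0 + x 1 + t`.  The face `v` lies strictly between the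
`𝕋`-lines numbered `rowCoord i v` and `rowCoord i v + 1` of family `i`. -/
def rowCoord (i : Fin 3) (v : HexVertex) : ℤ :=
  if i = 0 then v.1 1 else if i = 1 then v.1 0 else v.1 0 + v.1 1 + (v.2 : ℕ)

/-- The six SIGNED row coordinates: `rowOf k` increases in the direction `ζ^k · i` normal to the
lattice lines of direction `ζ^k` (`ζ = e^{iπ/3}`), so that `{v | m ≤ rowOf k v}` is the exact
half-lattice lying on the side `ζ^k · i` of a `𝕋`-line of direction `ζ^k` — the lattice clause of
`HexObservableLimitR` (`k = 0`: `rowOf 0 v = v.1 1`) in all six orientations. -/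
def rowOf (k : Fin 6) (v : HexVertex) : ℤ :=
  ![rowCoord 0 v, -rowCoord 1 v, -rowCoord 2 v, -rowCoord 0 v, rowCoord 1 v, rowCoord 2 v] k

/-- The lattice hexagon of size `n` around the vertex `c` ("level `n`"): all three row coordinates
within `n` of those of `c`.  Its boundary consists of six flat zigzag sides. -/
def hexBall (c : HexVertex) (n : ℕ) : Set HexVertex :=
  {v | ∀ i : Fin 3, |rowCoord i v - rowCoord i c| ≤ n}

/-- The three skew coordinates of a point of the plane (`z = x₀ + x₁ ζ`): `skewCoord 0 z = x₁`,
`skewCoord 1 z = x₀`, `skewCoord 2 z = x₀ + x₁`; the face centre `hexCenter v` has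
`skewCoord i (hexCenter v) ∈ (rowCoord i v, rowCoord i v + 1)`. -/
def skewCoord (i : Fin 3) (z : ℂ) : ℝ :=
  ![2 * z.im / Real.sqrt 3, z.re - z.im / Real.sqrt 3, z.re + z.im / Real.sqrt 3] i

/-- The CLOSED continuum hexagon at mesh `δ` carrying the lattice hexagon `hexBall c n`: the union of
the closed `δ𝕋`-triangles of its faces,
`{z | ∀ i, rowCoord i c - n ≤ skewCoord i (z/δ) ≤ rowCoord i c + n + 1}`.  Convex; its sides lie on
`𝕋`-lines of mesh `δ`. -/
def contHex (δ : ℝ) (c : HexVertex) (n : ℕ) : Set ℂ :=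
  {z | ∀ i : Fin 3, (rowCoord i c : ℝ) - n ≤ skewCoord i (z / δ) ∧
    skewCoord i (z / δ) ≤ (rowCoord i c : ℝ) + n + 1}

/-- The gate point of the lattice edge `{p, q}` at mesh `δ`: the midpoint of the rescaled dual edge,
i.e. the point where it crosses the `𝕋`-line separating the two faces. -/
def gatePoint (δ : ℝ) (p q : HexVertex) : ℂ :=
  (δ : ℂ) * (hexCenter p + hexCenter q) / 2

/-- The CROSSCUT of the domain `Ω` through the gate: the connected component, in
`∂(contHex δ c n) ∩ Ω`, of the gate point of `{p, q}` (an open arc of the hexagon boundary inside `Ω`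
with its two ends on `∂Ω`; junk `∅` if the gate point is not on it). -/
def gateCut (Ω : Set ℂ) (δ : ℝ) (c : HexVertex) (n : ℕ) (p q : HexVertex) : Set ℂ :=
  connectedComponentIn (frontier (contHex δ c n) ∩ Ω) (gatePoint δ p q)

/-- The `p`-SIDE (root side) of the gate: the connected component of `Ω ∖ gateCut` containing the
rescaled centre of `p`.  For a walk leaving the hexagon at `{p,q}` this is the side of the root: the
inner continuum component of the hexagon together with every lobe of `Ω` attached to it across other
arcs of the hexagon boundary; when the walk then reaches the far marked point without returning, the
root side is bounded by the crosscut and the SHORT arc of `∂Ω` (diameter `→ 0` with the level), and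
its complement side is the Jordan domain bounded by the crosscut and the long arc. -/
def gateSide (Ω : Set ℂ) (δ : ℝ) (c : HexVertex) (n : ℕ) (p q : HexVertex) : Set ℂ :=
  connectedComponentIn (Ω \ gateCut Ω δ c n p q) ((δ : ℂ) * hexCenter p)

/-- The lattice shadow of the root side: honeycomb vertices whose rescaled centre lies in it. -/
def sideVerts (Ω : Set ℂ) (δ : ℝ) (c : HexVertex) (n : ℕ) (p q : HexVertex) : Set HexVertex :=
  {v | (δ : ℂ) * hexCenter v ∈ gateSide Ω δ c n p q}

/-- A CLEAN FLAT WINDOW of radius `ρ` at the gate `{p,q}` relative to the root-side vertex set `S`: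
the closed `ρ`-ball about the rescaled centre of `q` lies in `Ω`, `q` is one signed row beyond `p` in
some orientation `k`, and inside the ball membership in `S` is EXACTLY the half-lattice condition
`rowOf k · ≤ rowOf k p` — so the far side is, near its new root `q`, the exact half-lattice
`{rowOf k · ≥ rowOf k p + 1}` above a flat zigzag side lying on a `𝕋`-line: the root clause of
`HexObservableLimitR` in orientation `ζ^k` (hexagon corners and `∂Ω` are then automatically
`ρ`-far from the gate). -/
def HasCleanWindow (Ω : Set ℂ) (δ ρ : ℝ) (S : Set HexVertex) (p q : HexVertex) : Prop :=
  closedBall ((δ : ℂ) * hexCenter q) ρ ⊆ Ω ∧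
    ∃ k : Fin 6, rowOf k q = rowOf k p + 1 ∧
      ∀ x : HexVertex, (δ : ℂ) * hexCenter x ∈ ball ((δ : ℂ) * hexCenter q) ρ →
        (x ∈ S ↔ rowOf k x ≤ rowOf k p)

/-- `l` makes its FIRST EXIT from the lattice hexagon of size `n` around `c` at index `m` through
the edge `{p, q}`: the first `m` entries lie in the hexagon, the last of them is `p`, the next entry
`q` lies outside (so `m`, `p`, `q` are determined by `l` and `n`). -/
def IsFirstExit (c : HexVertex) (n : ℕ) (l : List HexVertex) (m : ℕ) (p q : HexVertex) : Prop :=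
  (l.take m).getLast? = some p ∧ (l.drop m).head? = some q ∧
    (∀ v ∈ l.take m, v ∈ hexBall c n) ∧ q ∉ hexBall c n

/-- A GOOD GATE of the vertex list `l` (read from its initial vertex `c = l.head`) at level `n` in
the scale window `[r, R]` with window radius `ρ`: `l` first leaves the lattice hexagon of size `n`
around `c` through `{p, q}`, NEVER RETURNS to the root side of the crosscut through that gate (single
crossing), and the gate carries a clean flat window. -/
def IsGoodGate (Ω : Set ℂ) (δ r R ρ : ℝ) (c : HexVertex) (l : List HexVertex) (n m : ℕ)
    (p q : HexVertex) : Prop :=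
  r ≤ n * δ ∧ n * δ ≤ R ∧ IsFirstExit c n l m p q ∧
    (∀ v ∈ l.drop m, v ∉ sideVerts Ω δ c n p q) ∧
    HasCleanWindow Ω δ ρ (sideVerts Ω δ c n p q) p q

/-- The FIRST good gate: a good gate at the minimal good level (one gate per list, if any: at a
given level the first-exit data are determined by the list). -/
def IsFirstGoodGate (Ω : Set ℂ) (δ r R ρ : ℝ) (c : HexVertex) (l : List HexVertex) (n m : ℕ)
    (p q : HexVertex) : Prop :=
  IsGoodGate Ω δ r R ρ c l n m p q ∧
    ∀ (n' m' : ℕ) (p' q' : HexVertex), IsGoodGate Ω δ r R ρ c l n' m' p' q' → n ≤ n'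

/-- `l` has a good gate at some level of the window. -/
def GoodRenewalAt (Ω : Set ℂ) (δ r R ρ : ℝ) (c : HexVertex) (l : List HexVertex) : Prop :=
  ∃ (n m : ℕ) (p q : HexVertex), IsGoodGate Ω δ r R ρ c l n m p q

/-- The critical SAW weight `x_c^{ℓ}` on the SAWs of `Ω_δ` from `u` to `v` that AVOID the vertex
set `S` (in the line: the union of the two root sides): the un-normalised middle law. -/
def carvedWeight (Ω : Set ℂ) (δ : ℝ) (S : Set HexVertex) (u v : HexVertex) :
    Measure (HexDomainSAW Ω δ u v) :=
  (hexSAWWeight Ω δ u v).restrict {γ | ∀ x ∈ γ.walk.support, x ∉ S}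

/-- The CARVED LAW: the critical SAW of `Ω_δ` from `u` to `v` conditioned to avoid `S`, i.e. the
critical SAW law of the lattice domain `Ω_δ ∖ S` (junk `0` if there is no such walk). -/
def carvedLaw (Ω : Set ℂ) (δ : ℝ) (S : Set HexVertex) (u v : HexVertex) :
    Measure (HexDomainSAW Ω δ u v) :=
  (carvedWeight Ω δ S u v Set.univ)⁻¹ • carvedWeight Ω δ S u v

/-! ## Typed statements of the line (waypoints; every stub is one of them or an implication between them) -/

/-- **EXACT TWO-GATE FACTORISATION (the lever; law level).**  In any domain `Ω_δ`, for disjoint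
vertex sets `S ⊇ l₁` (`l₁` the support of a SAW `a → p` of `Ω_δ`) and `T ⊇ l₂` (`l₂` the support of
a SAW `p' → b`) and lattice edges `p ∼ q`, `q' ∼ p'` of `Ω_δ`: the `x_c`-weight of the walks `a → b`
whose support is `l₁ ++ mid ++ l₂` with `mid` running from `q` to `q'`, avoiding `S ∪ T` and lying
in an arbitrary set `B` of lists, equals `x_c^{|l₁|+|l₂|}` times the `x_c`-weight of the SAWs
`q → q'` of `Ω_δ` avoiding `S ∪ T` with support in `B` — concatenation is a weight-preserving
bijection (vertex sets disjoint, junction edges `{p,q}`, `{q',p'}`, `x_c^{#vertices}` multiplies).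
Kesten's bridge renewal / the exact restriction property of the SAW as an identity of measures;
the vertex-walk form of the card's `GateFactorisation` / card 3's `RenewalFactorisation`
(both audited correct by the triage panel and Disproof §10). -/
def GateDecomposition : Prop :=
  ∀ (Ω : Set ℂ) (δ : ℝ) (a b p q p' q' : HexVertex) (S T : Set HexVertex) (l₁ l₂ : List HexVertex)
    (B : Set (List HexVertex)),
    Disjoint S T →
    (∃ w₁ : (hexDomainGraph Ω δ).Walk a p, w₁.IsPath ∧ w₁.support = l₁ ∧ ∀ v ∈ l₁, v ∈ S) →
    (∃ w₂ : (hexDomainGraph Ω δ).Walk p' b, w₂.IsPath ∧ w₂.support = l₂ ∧ ∀ v ∈ l₂, v ∈ T) →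
    (hexDomainGraph Ω δ).Adj p q → (hexDomainGraph Ω δ).Adj q' p' →
    hexSAWWeight Ω δ a b
        {γ | ∃ mid ∈ B, mid.head? = some q ∧ mid.getLast? = some q' ∧
          (∀ v ∈ mid, v ∉ S ∧ v ∉ T) ∧ γ.walk.support = l₁ ++ mid ++ l₂} =
      ENNReal.ofReal (hexCriticalFugacity ^ (l₁.length + l₂.length)) *
        hexSAWWeight Ω δ q q'
          {γ | γ.walk.support ∈ B ∧ ∀ v ∈ γ.walk.support, v ∉ S ∧ v ∉ T}

/-- **RA — RENEWAL ACCUMULATION at both endpoints (the one new a-priori input; load-bearing).**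
For the canonical critical hexagonal SAW of any Dobrushin domain with any endpoint approximation:
for every `ε > 0` and every upper scale `R > 0` there are a lower scale `r ∈ (0, R)` and a window
radius `ρ > 0` such that, for all small meshes, with probability `≥ 1 − ε` the walk has a good gate
at a level of the window `[r, R]` around its starting vertex AND (read backwards) around its end
vertex.  Lattice shadow of Alberts–Duminil-Copin (arXiv:0909.0203 Thm 1.2/1.3: the bridge heights of
the `5/8`-restriction measure form a scale-invariant perfect set of dimension `3/4` accumulating at
the root, inverse `3/4`-stable subordinator); half-plane core = Kesten's irreducible-bridge renewal
at `x_c` (`Σ_h I_h(x_c) = 1` from `B(x_c) = ∞`, Madras–Slade Cor. 3.1.8 / (4.2.4); DGKLP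
arXiv:1008.4321 §2) with a doubling-regular height tail (Erickson 1970). -/
def RenewalAccumulation : Prop :=
  ∀ (D : DobrushinDomain) (a b : ℝ → HexVertex), IsEmbEndpointApprox hexGraph hexCenter D a b →
    ∀ ε > (0 : ℝ), ∀ R > (0 : ℝ), ∃ r ∈ Set.Ioo (0 : ℝ) R, ∃ ρ > (0 : ℝ), ∀ᶠ δ : ℝ in 𝓝[>] 0,
      hexSAWLaw D.carrier δ (a δ) (b δ)
          {γ | ¬ (GoodRenewalAt D.carrier δ r R ρ (a δ) γ.walk.support ∧
                  GoodRenewalAt D.carrier δ r R ρ (b δ) γ.walk.support.reverse)} ≤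
        ENNReal.ofReal ε

/-- **`HexObservableLimitR` WITH FREE LATTICE ORIENTATIONS AT THE TWO BALLS (`R6`).**  Verbatim the
route hypothesis `HexObservableLimitR` (item stmt-CriticalPhenomena-14003) except that the two flat
pieces have independent lattice orientations `ζ^{k i}` (`k : Fin 2 → Fin 6`): inside `B(pt i, ρ)`
the domain is the half-plane `{im (conj(ζ^{k i}) (z − pt i)) > 0}` (= Disproof's
`FlatAt D i (ζ^{k i}) ρ`) and the discretisation is the exact half-lattice
`v ∈ Λ δ ↔ m i δ ≤ rowOf (k i) v`.  `k ≡ 0` is `HexObservableLimitR` (`hexObservableLimitR_of_R6`);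
the corridor witness refuting the root-free form (item 5420, Disproof §5 `not_rootFree`) needs a FREE
collar at a marked point and is excluded here exactly as in `R` (rigid exact balls at both points,
in every orientation class).  This is the recommended re-typing of item 14003. -/
def HexObservableLimitR6 : Prop :=
  ∃ c : ℂ, c ≠ 0 ∧ ∀ (D : DobrushinDomain) (ρ : ℝ) (k : Fin 2 → Fin 6)
    (Λ : ℝ → Finset HexVertex) (m : Fin 2 → ℝ → ℤ) (a b : ℝ → Sym2 HexVertex)
    (Φ : ConformalEquiv D.carrier UpperHalfPlane.upperHalfPlaneSet) (L : ℂ → ℂ) (Lb : ℂ) (ψ : ℂ → ℂ),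
    let F : ℝ → Sym2 HexVertex → ℂ := fun δ z =>
      hexParafermionicObservable (Λ δ) (a δ) hexCriticalFugacity (5 / 8) z
    0 < ρ →
    (∀ i : Fin 2, D.carrier ∩ ball (D.pt i) ρ =
      {z : ℂ | 0 < (starRingEnd ℂ (triZeta ^ (k i : ℕ)) * (z - D.pt i)).im} ∩ ball (D.pt i) ρ) →
    (∀ᶠ δ : ℝ in 𝓝[>] 0,
      hexDomainSimplyConnected (Λ δ) ∧ a δ ∈ hexDomainBoundary (Λ δ) ∧
        b δ ∈ hexDomainBoundary (Λ δ) ∧ Nonempty (HexMidEdgeSAW (Λ δ) (a δ) (b δ)) ∧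
        (hexGraph.induce ((Λ δ : Finset HexVertex) : Set HexVertex)).Preconnected ∧
        (∀ v ∈ Λ δ, (δ : ℂ) * hexCenter v ∈ D.carrier) ∧
        (∀ i : Fin 2, ∀ v : HexVertex, (δ : ℂ) * hexCenter v ∈ ball (D.pt i) ρ →
          (v ∈ Λ δ ↔ m i δ ≤ rowOf (k i) v))) →
    (∀ K : Set ℂ, IsCompact K → K ⊆ D.carrier → ∀ᶠ δ : ℝ in 𝓝[>] 0,
      ∀ v : HexVertex, (δ : ℂ) * hexCenter v ∈ K → v ∈ Λ δ) →
    Tendsto (fun δ : ℝ => (δ : ℂ) * hexMidpoint (a δ)) (𝓝[>] 0) (𝓝 (D.pt 0)) →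
    Tendsto (fun δ : ℝ => (δ : ℂ) * hexMidpoint (b δ)) (𝓝[>] 0) (𝓝 (D.pt 1)) →
    Tendsto (fun x => ‖Φ x‖) (𝓝[D.carrier] (D.pt 0)) atTop →
    Φ.HasBoundaryValue (D.pt 1) 0 →
    ContinuousOn L D.carrier → (∀ z ∈ D.carrier, Complex.exp (L z) = deriv Φ z) →
    Tendsto L (𝓝[D.carrier] (D.pt 1)) (𝓝 Lb) →
    Continuous ψ → HasCompactSupport ψ → tsupport ψ ⊆ D.carrier →
    Tendsto (fun δ : ℝ => (δ : ℂ) ^ 2 * (∑ᶠ e ∈ hexDomainMidEdges (Λ δ),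
      ψ ((δ : ℂ) * hexMidpoint e) * F δ e) / F δ (b δ)) (𝓝[>] 0)
      (𝓝 (c * ∫ z, ψ z * Complex.exp ((5 / 8 : ℂ) * (L z - Lb))))

/-- **RADÓ CONTINUITY OF THE SLE(8/3) LAW, uniform form at a fixed target.**  For every Dobrushin
domain `D`, bounded continuous `f` and `ε > 0` there is `η > 0` such that every Dobrushin domain whose
boundary loop is uniformly `η`-close to that of `D` (same parameter) and whose two marked points are
`η`-close to those of `D` has its chordal SLE(8/3) law `ε`-close to that of `D` against `f`.
Radó's theorem (tree, PROVED: `JordanDomain.rado_tendstoUniformlyOn_holds`, closed-disc form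
`rado_tendstoUniformlyOn.closedBall`) + a Möbius re-normalisation of the disc matching the two marks +
`ChordalFamily.isRadoContinuous_of_forall_isSLELaw` (tree, PROVED) + uniqueness of the SLE law
(`IsSLECurve.map_eq_holds`); by contradiction along a sequence. -/
def SLELawContinuity : Prop :=
  ∀ (D : DobrushinDomain) (f : CurveClass ℂ →ᵇ ℝ) (ε : ℝ), 0 < ε → ∃ η > (0 : ℝ),
    ∀ (M : DobrushinDomain), (∀ t : ℝ, dist (M.boundary t) (D.boundary t) ≤ η) →
      dist (M.pt 0) (D.pt 0) ≤ η → dist (M.pt 1) (D.pt 1) ≤ η →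
      ∀ μ ν : Measure (CurveClass ℂ), IsSLELaw ((8 : ℝ≥0) / 3) M μ → IsSLELaw ((8 : ℝ≥0) / 3) D ν →
        |∫ x, f x ∂μ - ∫ x, f x ∂ν| ≤ ε

/-- **CARVED MIDDLE PIECES CONVERGE TO SLE(8/3) OF THE TARGET, uniformly in probability over the
walk's own first good gates (K2 — the identification engine of the line, in the two-ball
lattice-flat-pinned class).**  For a Dobrushin domain `D`, an endpoint approximation, the SLE(8/3) law
`ν` of `D`, a test function `f` and `ε > 0`: once the upper cut scale `R` is below some `R₀`, for
every window `[r, R]`, every window radius `ρ` and all small meshes, the `hexSAWLaw`-probability that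
the walk's FIRST good gates `(n; p, q)` at `a δ` and `(n'; p', q')` at `b δ` (list reversed) carve a
middle law `carvedLaw` — the critical SAW of `Ω_δ` from `q` to `q'` avoiding the two root sides, i.e.
a chordal critical SAW of the Jordan domain `V ∩ V'` (far sides of the two crosscuts) between two
points of flat zigzag sides lying ON lattice lines, with exact half-lattice `ρ`-balls at both: an
instance of the class of `R6` — whose `f`-integral is more than `ε` away from `∫ f dν`, is at most
`ε`.  Content: identification of (subsequential) limits in that class from `R6` (+ `HexTight`),
uniformly along convergent cut data (approach of the cut level from above AND from below; cut
domains of walks realising the gates have loops uniformly `o_R(1)`-close to `∂D` by the short-arc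
argument), then `R → 0` on SLE laws by `SLELawContinuity`.  Stated in probability (not `sup`) form so
that cut configurations of vanishing probability (near-tangencies of `∂D` with the cut) may be
discarded by the prover. -/
def CarvedToSLE : Prop :=
  ∀ (D : DobrushinDomain) (a b : ℝ → HexVertex), IsEmbEndpointApprox hexGraph hexCenter D a b →
    ∀ (ν : Measure (CurveClass ℂ)), IsSLELaw ((8 : ℝ≥0) / 3) D ν →
    ∀ (f : CurveClass ℂ →ᵇ ℝ) (ε : ℝ), 0 < ε →
      ∃ R₀ > (0 : ℝ), ∀ R ∈ Set.Ioc (0 : ℝ) R₀, ∀ r ∈ Set.Ioc (0 : ℝ) R, ∀ ρ > (0 : ℝ),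
        ∀ᶠ δ : ℝ in 𝓝[>] 0,
          hexSAWLaw D.carrier δ (a δ) (b δ)
            {γ | ∃ (n m : ℕ) (p q : HexVertex) (n' m' : ℕ) (p' q' : HexVertex),
                IsFirstGoodGate D.carrier δ r R ρ (a δ) γ.walk.support n m p q ∧
                IsFirstGoodGate D.carrier δ r R ρ (b δ) γ.walk.support.reverse n' m' p' q' ∧
                ε < |(∫ ξ, f ξ.curve ∂(carvedLaw D.carrier δ
                        (sideVerts D.carrier δ (a δ) n p q ∪ sideVerts D.carrier δ (b δ) n' p' q')
                        q q')) - ∫ x, f x ∂ν|} ≤ ENNReal.ofReal ε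

/-- **Identification everywhere** — verbatim the `hid` hypothesis of the landed soft half
`convergesInLawToSLE_of_identification` (Negative/Identification), for every target: every
probability subsequential limit law of the critical hexagonal SAW curves is the chordal SLE(8/3)
law.  (Equivalent to the crux given `R`, `HexTight`: Disproof §3 `crux_iff_identification`.) -/
def FullIdentification : Prop :=
  ∀ (D : DobrushinDomain) (a b : ℝ → HexVertex),
    IsEmbEndpointApprox hexGraph hexCenter D a b →
    ∀ μ : Measure (CurveClass ℂ), IsProbabilityMeasure μ →
      IsSubseqLimitLaw (fun δ (γ : HexDomainSAW D.carrier δ (a δ) (b δ)) => γ.curve)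
        (fun δ => hexSAWLaw D.carrier δ (a δ) (b δ)) μ →
      IsSLELaw ((8 : ℝ≥0) / 3) D μ

/-! ## Consistency check: `R6` specialises to `R` -/

/-- `rowOf 0` is the row function `v ↦ v.1 1` of `HexObservableLimitR`'s lattice clause. -/
theorem rowOf_zero (v : HexVertex) : rowOf 0 v = v.1 1 := by
  simp [rowOf, rowCoord]

/-- **`R6` with both orientations `ζ^0 = 1` is `R`:** the free-orientation form is typed consistently
with the route hypothesis (flat clause `{im(1̄ (z − p)) > 0} = {im p < im z}`, lattice clause
`rowOf 0 v = v.1 1`). -/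
theorem hexObservableLimitR_of_R6 (h : HexObservableLimitR6) : HexObservableLimitR := by
  obtain ⟨c, hc, H⟩ := h
  refine ⟨c, hc, ?_⟩
  intro D ρ Λ m a b Φ L Lb ψ F hρ hflat hdisc hK ha hb hΦ hΦb hL hexp hLb hψ hψK hψD
  have hflat' : ∀ i : Fin 2, D.carrier ∩ ball (D.pt i) ρ =
      {z : ℂ | 0 < (starRingEnd ℂ (triZeta ^ ((fun _ : Fin 2 => (0 : Fin 6)) i : ℕ)) *
        (z - D.pt i)).im} ∩ ball (D.pt i) ρ := by
    intro i
    rw [hflat i]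
    ext z
    simp [sub_pos]
  have hdisc' : ∀ᶠ δ : ℝ in 𝓝[>] 0,
      hexDomainSimplyConnected (Λ δ) ∧ a δ ∈ hexDomainBoundary (Λ δ) ∧
        b δ ∈ hexDomainBoundary (Λ δ) ∧ Nonempty (HexMidEdgeSAW (Λ δ) (a δ) (b δ)) ∧
        (hexGraph.induce ((Λ δ : Finset HexVertex) : Set HexVertex)).Preconnected ∧
        (∀ v ∈ Λ δ, (δ : ℂ) * hexCenter v ∈ D.carrier) ∧
        (∀ i : Fin 2, ∀ v : HexVertex, (δ : ℂ) * hexCenter v ∈ ball (D.pt i) ρ →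
          (v ∈ Λ δ ↔ m i δ ≤ rowOf ((fun _ : Fin 2 => (0 : Fin 6)) i) v)) :=
    hdisc.mono fun δ hδ => ⟨hδ.1, hδ.2.1, hδ.2.2.1, hδ.2.2.2.1, hδ.2.2.2.2.1, hδ.2.2.2.2.2.1,
      fun i v hv => by rw [rowOf_zero]; exact hδ.2.2.2.2.2.2 i v hv⟩
  exact H D ρ (fun _ => 0) Λ m a b Φ L Lb ψ hρ hflat' hdisc' hK ha hb hΦ hΦb hL hexp hLb hψ hψK hψD

/-! ## Registered stubs -/

/-- STUB 1 — `GateDecomposition` (size M; PROVABLE NOW; the lever).  Proof: both sides are sums of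
`x_c^{#vertices}` over finite sets of SAWs (`hexSAWWeight = Measure.sum (x_c^{vertexCount} • dirac)`,
`vertexCount = support.length`, `embWeight_singleton`); the map `γ ↦` (the sub-walk of `γ` with
support `mid`) is a bijection from the left set onto the right set with inverse "concatenate
`w₁`, the edge `{p,q}`, the middle walk, the edge `{q',p'}`, `w₂`" — a SAW because `l₁ ⊆ S`,
`mid ∩ (S ∪ T) = ∅`, `l₂ ⊆ T`, `S ∩ T = ∅`, and a walk of `Ω_δ` because every edge is one (a walk of
a simple graph is determined by its support: `SimpleGraph.Walk.ext_support`-type lemma); lengths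
add.  Sources: Kesten 1963 §4; Madras–Slade 1993 §4.2; LSW arXiv:math/0204277 §3.4 (restriction
property of SAW); card `Ideas/bridge-gate-renewal.md` First lemma; Disproof §10 audit. -/
theorem stub_gateDecomposition : GateDecomposition := by
  sorry

/-- STUB 2 — `RenewalAccumulation` (size XL; OPEN — the HARDEST stub and the one new input of the
line; renewal species, no separation/RSW technology for SAW is used or available).  Why plausible:
(i) continuum shadow PROVED (Alberts–Duminil-Copin 2010 Thm 1.2/1.3: for the `5/8`-restriction
measure = SLE(8/3), bridge scales accumulate at the root with dimension `3/4`; the hexagon-level /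
crosscut version is the same local restriction computation); (ii) the half-plane lattice core is
Kesten's EXACT renewal at `x_c` (`Σ_h I_h(x_c) = 1` because `B(x_c) = ∞`, tree `HexSAWLowerBound`
`c/T ≤ B_T`; DGKLP 2011 §2: strip SAW = half-plane SAW conditioned on a bridge), so "no renewal
height in `[r/δ, R/δ]`" is a statement about ONE explicit distribution (doubling-regular tail of
index `3/4` expected; Erickson's infinite-mean renewal bounds); (iii) clean windows cost a bounded
factor (Kesten patterns / multi-surgery, tree `SAWKestenPatterns`, `SAWMultiSurgery`); (iv) Jordan
geometry: the root sides at level `s` have diameter `→ 0` (short-arc argument), so avoiding `U` after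
the gate costs nothing macroscopic; `ρ` is chosen after `r` (outward cusps at the marked point are
harmless, TRIAGE r1-2/3), the upper scale `R` is free (needed by stub 5/6).  Why it might fail:
microscopic re-crossing fuzz at every mesoscopic level with conditional probability `→ 1`
(a slowly varying irreducible-bridge height tail at `x_c` would void whole windows — Disproof §10's
"BET"); wild prime ends.  Cheapest falsifier (kit, first compute job of the line): honeycomb strip
transfer matrix for `I_h(x_c)`, `h ≤ 12`: Kesten sum `→ 1` and tail `∝ h^{-3/4}`.
Sources: arXiv:0909.0203 (Thm 1.2, 1.3, §4, Q. 6.6); arXiv:1008.4321 §2; MadrasSlade1993 Cor. 3.1.8,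
(4.2.4); Kesten1963 §4; Erickson 1970 (TAMS 151); LawlerSchrammWerner2004SAW §3.4. -/
theorem stub_renewalAccumulation : RenewalAccumulation := by
  sorry

/-- STUB 3 — ORIENTATION TRANSFER `R → R6` (size L–XL, OPEN under `R` as typed; size S if the route
planners re-type item 14003 with independent orientations, which all three triagers and Disproof §8
recommend — then this stub is `fun h => h` up to the renaming).  Content under `R` as typed:
(a) a global lattice rotation by `ζ^{k₀}` about the origin (a symmetry of `hexCenter`'s honeycomb:
`ζ · ℤ[ζ] = ℤ[ζ]`, faces to faces) and the exact rotation covariance of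
`hexParafermionicObservable` (total winding is rotation invariant), of `Φ ↦ Φ ∘ rot⁻¹`,
`L ↦ L ∘ rot⁻¹ − i k₀ π/3` (so `L − Lb` is unchanged), `ψ ↦ ψ ∘ rot⁻¹` reduce `(k₀, k₁)` to the
relative class `(0, k₁ − k₀)`; complex conjugation (a reflection symmetry of the honeycomb) identifies
classes `j` and `−j`; (b) the three genuinely new relative classes `60°, 120°, 180°` need flat-piece
terminal locality at `b` (the ratio field `F_δ(z)/F_δ(b_δ)` near a flat zigzag piece has a
δ-independent limit profile calibrated by `R` in class `0`) — the card's S1, locality species.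
Why it might fail: (b) is a genuine locality statement about the observable near a flat boundary
piece, of the calibre of the sibling lines' arch-locality anchor.  Disproof §8
`obsLimitRBody_of_relativeClass_ne`: `R` itself is silent on every nonzero relative class, so no
cheaper route exists inside `R`.  Sources: arXiv:1007.0575 Conj. 2 (orientation-free as printed);
KennedyLawler2013 (lattice effects at flat boundaries are local); TRIAGE r1-1/2/3. -/
theorem stub_orientationTransfer : HexObservableLimitR → HexObservableLimitR6 := by
  sorry

/-- STUB 4 — `SLELawContinuity` (size M–L; PROVABLE NOW from tree facts).  By contradiction: Dobrushin
domains `M_n` with `‖M_n.boundary − D.boundary‖_∞ → 0` and marks `→` those of `D` but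
`|∫ f dμ_n − ∫ f dν| ≥ ε`.  Fix `z₀ ∈ D` (inside `M_n` eventually: winding number); Riemann maps
`f_n : 𝔻 → M_n`, `f : 𝔻 → D` with `f_n(0) = f(0) = z₀`, `f_n'(0), f'(0) > 0`
(`exists_conformalEquiv`-type facts of the tree's Carathéodory files); Radó
(`JordanDomain.rado_tendstoUniformlyOn_holds` + `.closedBall` with the Carathéodory extensions
`JordanDomain.exists_continuousOn_extension`) gives `f_n → f` uniformly on `𝔻̄`; the preimages of the
marks converge (`f` injective on `𝔻̄`), so disc automorphisms `T_n → id` (uniformly on `𝔻̄`) with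
`f_n ∘ T_n` mapping the two fixed preimages `ξ₀, ξ₁` of `a, b` to the marks of `M_n` exist; apply
`ChordalFamily.isRadoContinuous_of_forall_isSLELaw` (RadoContinuitySLE, PROVED) to the SLE(8/3)
family with parameter domain the disc marked at `ξ₀, ξ₁` and `Φ_n := f_n ∘ T_n → f`; conclude with
uniqueness of the SLE law (`IsSLECurve.map_eq_holds` / `isSLELaw_of_isSubseqLimitLaw` pattern).
Sources: PommerenkeBBCM1992 Thm 2.11 (Radó), Thm 2.6; Lawler2005 §6.1. -/
theorem stub_sleLawContinuity : SLELawContinuity := by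
  sorry

/-- STUB 5 — `GateDecomposition → R6 → HexTight → SLELawContinuity → CarvedToSLE` (size XL; OPEN — identification in the
two-ball lattice-flat-pinned class; in substance the target of the restriction lines of crux 10472
(`Cruxes/ObservableToSLE/Lines/*`: target transport, short-chord locality, restriction cocycle,
LSW closing), LOCAL two-ball version in all six-by-six orientations, made UNIFORM along convergent
cut data).  Scheme: (1) for a cut configuration realised by a walk, the middle lattice domain
(`Ω_δ`-vertices outside `U_δ ∪ U'_δ`, component of `q`) is the mesh discretisation of the Jordan
domain `M = V ∩ V'` (far sides of the two crosscuts; Jordan: crosscut of a Jordan domain; no lattice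
pockets by construction of `sideVerts` through continuum sides), exact half-lattice in the two
`ρ`-balls at the gate points `gatePoint δ p q ∈ ∂M`, `gatePoint δ p' q'` (which lie ON `𝕋`-lines);
(2) identification: every subsequential limit of `curve_*(carvedLaw)` along cut data converging
(Hausdorff / Carathéodory + marks) is SLE(8/3) of the limit marked domain, from `R6` at the
flat-pinned domains (restriction/observable machinery of the 10472 lines) — approach of the cut level
from BELOW is handled by comparing with the configuration's own exact cut domain (moving target),
not with a fixed limit domain; tightness of middle pieces comes from `HexTight` for the whole curve
(sub-arcs inherit the modulus; the middle piece IS a sub-arc of the whole walk on each cell of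
`GateDecomposition`, handed in as the first hypothesis) in `hexSAWLaw`-average, which is all the
probability form needs;
(3) `SLELawContinuity` with `‖∂M − ∂D‖_∞ ≤ diam(U) + diam(U') ≤ 6R + osc_{∂D}(τ_D(3R)) → 0`
(`U` is bounded by the crosscut and the SHORT arc of `∂D`: its closure contains `a` and not `b`).
Why it might fail: it contains Conj.-2-class identification (open since 2010) and the
canonical-vs-admissible transfer of the 10472 lines; near-tangency of `∂D` with cuts gives pinched
(non-Jordan) limit domains, to be discarded in probability or treated by hand.
Sources: LawlerSchrammWerner2003 Thm 6.1, LawlerSchrammWerner2004SAW §3.4, arXiv:1007.0575 Conj. 2,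
KemppainenSmirnov2017 (Carathéodory-uniform framework), PommerenkeBBCM1992 §2.4 (crosscuts),
`Cruxes/ObservableToSLE/Lines/floor-ratio-restriction-bootstrap.lean` (stubs 1–6). -/
theorem stub_carvedToSLE :
    GateDecomposition → HexObservableLimitR6 → HexTight → SLELawContinuity → CarvedToSLE := by
  sorry

/-- STUB 6 — THE GATE TRANSFER `GateDecomposition → RenewalAccumulation → CarvedToSLE → HexTight →
FullIdentification` (size L; PROVABLE NOW — soft measure theory + planar topology of crosscuts; this
is the card's `Transfer:` `C⁺ → crux conclusion`).  Fix `D, a, b`, a probability subsequential limit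
`μ` along `s_j → 0⁺`, the SLE(8/3) law `ν` of `D` (`exists_isSLELaw`-type existence), a bounded
LIPSCHITZ `f`, `ε > 0`.  Take `R₀` from `CarvedToSLE`, `R ≤ R₀` so small that the level hexagons
around `a δ`, `b δ` are far apart, `(r, ρ)` from `RenewalAccumulation`.  For small `δ`:
(i) `hexSAWLaw` is a probability measure (`eventually_isProbabilityMeasure_hexSAWLaw`) and the good
event `G` (first good gates at both ends) has mass `≥ 1 − ε`; (ii) `G` is the disjoint union of the
cells `{first gates = (n;p,q), (n';p',q'), prefix = l₁, suffix = l₂}`, and EACH CELL IS A PRODUCT: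
`{γ | γ.support = l₁ ++ mid ++ l₂, mid : q → q' avoiding S ∪ T}` with `S = sideVerts … (a δ) n p q`,
`T = sideVerts … (b δ) n' p' q'` — because the prefix of a first exit lies in the root side
(`contHex` is convex; uniform local connectedness of Jordan domains at boundary touch points of edge
segments), lower levels' crosscuts lie inside `U` (nested hexagons, `c_{n₂} ∩ c_n = ∅`), so the
minimality and clean-window conditions do not depend on `mid`, and `S ∩ T = ∅` (`U ⊂ B(a, o_R(1))`
by the short-arc argument); (iii) `GateDecomposition` per cell: `hexSAWLaw|_cell =
P(cell) · (concat)_* carvedLaw`; (iv) `|f(curve(l₁++mid++l₂)) − f(curve mid)| ≤ Lip f · 3R`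
(reparametrise; `curve` is the polyline of the support, `SimpleGraph.Walk.toCurve`); (v) sum over
cells against `CarvedToSLE`: `|∫ f∘curve dP_δ − ∫ f dν| ≤ 4‖f‖ε + 3R·Lip f + ε`; (vi) let `δ = s_j → 0`,
then `ε, R → 0`: `∫ f dμ = ∫ f dν` for all bounded Lipschitz `f`, hence `μ = ν` (thickened indicators)
and `IsSLELaw (8/3) D μ`.  Sources: Billingsley 1999 §1–2; Disproof §3; the landed
`Negative/Identification` (`isSLELaw_of_isSubseqLimitLaw` pattern); Newman, Elements of the topology
of plane sets, §VI (ULC of Jordan domains, crosscuts). -/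
theorem stub_gateTransfer :
    GateDecomposition → RenewalAccumulation → CarvedToSLE → HexTight → FullIdentification := by
  sorry

/-! ## Composition (sorry-free): the skeleton concludes the crux BY NAME -/

/-- **`ObservableToSLER` from the six registered stubs**, through the landed soft half
`convergesInLawToSLE_of_identification` (Negative/Identification: Dirac padding + the tree's
convergence criterion + discharged uniqueness of the SLE law): `R` enters only through stubs 3 → 5,
`HexTight` through stubs 5, 6 and Prokhorov. -/
theorem ObservableToSLER_of : ObservableToSLER := by
  intro hO hT D a b hab
  have hfull : FullIdentification :=
    stub_gateTransfer stub_gateDecomposition stub_renewalAccumulation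
      (stub_carvedToSLE stub_gateDecomposition (stub_orientationTransfer hO) hT
        stub_sleLawContinuity) hT
  exact Summit.CriticalPhenomena.SAWScalingLimit.Theorems.ObservableToSLE.Negative.convergesInLawToSLE_of_identification
    hab (hT D a b hab) (hfull D a b hab)

end Summit.CriticalPhenomena.SAWScalingLimit.Cruxes.ObservableToSLER.BridgeGateRenewal

end
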